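import Mathlib
import Summits.MatrixMultiplication.MatrixMultiplication.Theorems.SubgroupIdentityDesigns.Negative.EigenLines
import Summits.MatrixMultiplication.MatrixMultiplication.Theorems.SubgroupIdentityDesigns.Negative.TwoPointActions
import Summits.MatrixMultiplication.MatrixMultiplication.Theorems.SubgroupIdentityDesigns.Negative.CellTwoOneClosed
import Summits.MatrixMultiplication.MatrixMultiplication.Theorems.SubgroupIdentityDesigns.Negative.SingerCycleOrder

/-!
# Dickson's list for `p`-free subgroups of `GL₂(𝔽_p)` — the `(2,1)` cell is empty for `p ≥ 47`

Route `LevelGradedCohnUmans`, crux `SubgroupIdentityDesigns` (stmt-MatrixMultiplication-14079), the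
`(m,k) = (2,1)` cell.  VALUE = THEOREM / DECIDABLE VERDICT on one cell, NOT summit progress: the
crux quantifies over all `(p, m, k)` and stays open.

`dicksonList_holds`: for odd `p` and a non-square `n`, every subgroup `H ≤ GL₂(𝔽_p)` of order prime
to `p` is conjugate into the monomial group, or into the normaliser of the non-split torus
`{[[a, n b], [± b, ± a]]}`, or has image of order `≤ 60` in `PGL₂(𝔽_p)` — the named hypothesis
`DicksonList p n` of `DicksonReduction.lean`, now a theorem.  Proof: `H` acts on `ℙ¹(K̄)`
(`ProjectiveLineAction`), every non-scalar element has exactly two fixed points (`EigenLines`,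
using `disc ≠ 0` from `PfreeAlgebra`), so `two_point_action` (`TwoPointActions`) applies; an
invariant pair of eigenlines of `g₀ ∈ H` makes every element of `H` commute or anti-commute with a
trace-zero square root `r ∈ 𝔽_p[g₀]` of `c • 1` (`c = 1` or `c = n`), which is conjugate to
`[[0, c], [1, 0]]` (`exists_conj_stdSinger`); for `c = 1` a further conjugation by `[[1,1],[1,-1]]`
lands in the monomial group.  Consequently (`cellTwoOne_empty`) the `(2,1)` cell of the crux has
NO witness for any prime `p ≥ 47` and any `0 < ε ≤ 1`, unconditionally
(`no_levelOne_witness_of_dicksonList_all'`).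
-/

set_option linter.dupNamespace false

noncomputable section

open scoped BigOperators Classical

open Summit.MatrixMultiplication.MatrixMultiplication.Theorems.LieRankDesigns.Negative (GLm Mat budget)
open Literature.NumberTheory.EllipticCurves.BinaryQuartic (two_ne_zero_zmod)
open Literature.Barriers.MatrixMultiplication (SubgroupTPP)

namespace Summit.MatrixMultiplication.MatrixMultiplication.Theorems.SubgroupIdentityDesigns.Negative

section DicksonTheorem

variable {p : ℕ} [hp : Fact p.Prime]

/-! ### Square roots of `c • 1` inside `𝔽_p[g₀]` -/

/-- Split case: if `disc M = δ² ≠ 0` then a genuine affine combination of `1, M` squares to `1`. -/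
theorem exists_sqrt_one_of_sq (hp2 : p ≠ 2) (M : Mat p 2) {δ : ZMod p} (hδ : δ * δ = disc M)
    (hδ0 : δ ≠ 0) :
    ∃ a b : ZMod p, b ≠ 0 ∧
      (a • (1 : Mat p 2) + b • M) * (a • (1 : Mat p 2) + b • M) = (1 : ZMod p) • (1 : Mat p 2) := by
  have h2 : (2 : ZMod p) ≠ 0 := two_ne_zero_zmod hp2
  unfold disc at hδ
  refine ⟨-(M 0 0 + M 1 1) / δ, 2 / δ, div_ne_zero h2 hδ0, ?_⟩
  have key2 : 2 * (-(M 0 0 + M 1 1) / δ) * (2 / δ) + 2 / δ * (2 / δ) * (M 0 0 + M 1 1) = 0 := by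
    field_simp; ring
  have key1 : -(M 0 0 + M 1 1) / δ * (-(M 0 0 + M 1 1) / δ) -
      2 / δ * (2 / δ) * (M 0 0 * M 1 1 - M 0 1 * M 1 0) = 1 := by
    field_simp
    linear_combination -hδ
  rw [sq_affine, mat2_sq_eq]
  ext i j
  fin_cases i <;> fin_cases j
  · simp
    linear_combination key1 + M 0 0 * key2
  · simp
    linear_combination M 0 1 * key2
  · simp
    linear_combination M 1 0 * key2
  · simp
    linear_combination key1 + M 1 1 * key2

/-- A non-scalar square root of a scalar has trace zero. -/
theorem trace_zero_of_sq {s : Mat p 2} {c : ZMod p} (hs : s * s = c • (1 : Mat p 2))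
    (hns : ¬ (s 0 1 = 0 ∧ s 1 0 = 0 ∧ s 1 1 = s 0 0)) : s 0 0 + s 1 1 = 0 := by
  by_contra ht
  apply hns
  have key := mat2_sq_eq s
  rw [hs] at key
  have e01 := congrArg (fun A : Mat p 2 => A 0 1) key
  have e10 := congrArg (fun A : Mat p 2 => A 1 0) key
  have e00 := congrArg (fun A : Mat p 2 => A 0 0) key
  have e11 := congrArg (fun A : Mat p 2 => A 1 1) key
  simp only [Matrix.sub_apply, Matrix.smul_apply, smul_eq_mul, Matrix.one_apply_eq,
    Matrix.one_apply_ne (by decide : (0 : Fin 2) ≠ 1),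
    Matrix.one_apply_ne (by decide : (1 : Fin 2) ≠ 0), mul_zero, mul_one, sub_zero] at e01 e10 e00 e11
  refine ⟨(mul_eq_zero.mp e01.symm).resolve_left ht, (mul_eq_zero.mp e10.symm).resolve_left ht, ?_⟩
  have : (s 0 0 + s 1 1) * (s 1 1 - s 0 0) = 0 := by linear_combination e00 - e11
  exact sub_eq_zero.mp ((mul_eq_zero.mp this).resolve_left ht)

/-! ### From shape± for `n = 1` to monomial -/

/-- `det [[1, 1], [1, -1]] = -2 ≠ 0` for odd `p`. -/
theorem hadamard_det_ne_zero (hp2 : p ≠ 2) :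
    (colMat (![1, 1] : Fin 2 → ZMod p) ![1, -1]).det ≠ 0 := by
  rw [colMat_det]
  simp only [Matrix.cons_val_zero, Matrix.cons_val_one]
  intro h
  apply two_ne_zero_zmod hp2
  linear_combination -h

/-- The matrix `[[1, 1], [1, -1]]` as an element of `GL₂(𝔽_p)`, `p` odd. -/
def hadamardGL (hp2 : p ≠ 2) : GLm p 2 :=
  Matrix.GeneralLinearGroup.mkOfDetNeZero (colMat ![1, 1] ![1, -1]) (hadamard_det_ne_zero hp2)

/-- Conjugating a shape± matrix for `n = 1` by `[[1, 1], [1, -1]]` gives a monomial matrix. -/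
theorem isMonomial_hadamard_conj (hp2 : p ≠ 2) {y : GLm p 2} (hy : IsSingerNormal 1 y) :
    IsMonomial ((hadamardGL hp2)⁻¹ * y * hadamardGL hp2) := by
  unfold hadamardGL
  have hv : ∀ c d : ZMod p, (y : Mat p 2).mulVec ![c, d] =
      ![(y : Mat p 2) 0 0 * c + (y : Mat p 2) 0 1 * d,
        (y : Mat p 2) 1 0 * c + (y : Mat p 2) 1 1 * d] := by
    intro c d
    ext i; fin_cases i <;> simp [Matrix.mulVec, dotProduct, Fin.sum_univ_two]
  rcases hy with ⟨h01, h11⟩ | ⟨h01, h11⟩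
  · apply isMonomial_conj_of_eigen (hadamard_det_ne_zero hp2)
      (α := (y : Mat p 2) 0 0 + (y : Mat p 2) 0 1) (β := (y : Mat p 2) 0 0 - (y : Mat p 2) 0 1)
    · rw [hv]; ext i; fin_cases i
      · simp
      · simp; linear_combination h11 - h01
    · rw [hv]; ext i; fin_cases i
      · simp; ring
      · simp; linear_combination -(h01 + h11)
  · apply isMonomial_conj_of_swap (hadamard_det_ne_zero hp2)
      (α := (y : Mat p 2) 0 0 + (y : Mat p 2) 0 1) (β := (y : Mat p 2) 0 0 - (y : Mat p 2) 0 1)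
    · rw [hv]; ext i; fin_cases i
      · simp
      · simp; linear_combination h11 + h01
    · rw [hv]; ext i; fin_cases i
      · simp; ring
      · simp; linear_combination h01 - h11

/-! ### The structure theorem for an invariant pair of eigenlines -/

/-- If every element of a `p`-free `H` fixes or swaps the two eigenlines of a non-scalar `g₀ ∈ H`,
then `H` is conjugate into the monomial group or into the normaliser of the non-split torus. -/
theorem dickson_of_invariant_pair (hp2 : p ≠ 2) {n : ZMod p} (hn : ∀ x : ZMod p, x * x ≠ n)
    {H : Subgroup (GLm p 2)} (hH : ¬ p ∣ Nat.card H) {g₀ : GLm p 2} (hg₀ : g₀ ∈ H)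
    (hns : g₀ ∉ (scalarHom p 2).range) (E : EigenData g₀)
    (hfs : ∀ h ∈ H,
      (h • Projectivization.mk (Kb p) E.u E.hu = Projectivization.mk (Kb p) E.u E.hu ∧
        h • Projectivization.mk (Kb p) E.w E.hw = Projectivization.mk (Kb p) E.w E.hw) ∨
      (h • Projectivization.mk (Kb p) E.u E.hu = Projectivization.mk (Kb p) E.w E.hw ∧
        h • Projectivization.mk (Kb p) E.w E.hw = Projectivization.mk (Kb p) E.u E.hu)) :
    (∃ g : GLm p 2, ∀ x ∈ H, IsMonomial (g * x * g⁻¹)) ∨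
    (∃ g : GLm p 2, ∀ x ∈ H, IsSingerNormal n (g * x * g⁻¹)) := by
  set G : Mat p 2 := (g₀ : Mat p 2) with hGdef
  have hΔ : disc G ≠ 0 := disc_ne_zero_of_pfree hp2 hH hg₀ hns
  -- a square root `r = a + b g₀` of `c • 1`, `c ∈ {1, n}`
  obtain ⟨c, hc, a, b, hb, hr⟩ : ∃ c : ZMod p, (c = 1 ∨ c = n) ∧ ∃ a b : ZMod p, b ≠ 0 ∧
      (a • (1 : Mat p 2) + b • G) * (a • (1 : Mat p 2) + b • G) = c • (1 : Mat p 2) := by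
    by_cases hsq : ∃ δ : ZMod p, δ * δ = disc G
    · obtain ⟨δ, hδ⟩ := hsq
      have hδ0 : δ ≠ 0 := by rintro rfl; apply hΔ; rw [← hδ, zero_mul]
      obtain ⟨a, b, hb, h⟩ := exists_sqrt_one_of_sq hp2 G hδ hδ0
      exact ⟨1, Or.inl rfl, a, b, hb, h⟩
    · push Not at hsq
      obtain ⟨a, b, hb, h⟩ := exists_sqrt_smul_one hp2 hn G hsq
      exact ⟨n, Or.inr rfl, a, b, hb, h⟩
  set r : Mat p 2 := a • (1 : Mat p 2) + b • G with hrdef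
  have hr00 : r 0 0 = a + b * G 0 0 := by simp [hrdef]
  have hr11 : r 1 1 = a + b * G 1 1 := by simp [hrdef]
  have hr01 : r 0 1 = b * G 0 1 := by simp [hrdef]
  have hr10 : r 1 0 = b * G 1 0 := by simp [hrdef]
  have hns_r : ¬ (r 0 1 = 0 ∧ r 1 0 = 0 ∧ r 1 1 = r 0 0) := by
    rintro ⟨h01, h10, h11⟩
    apply hns
    rw [mem_range_scalarHom_iff]
    rw [hr01] at h01; rw [hr10] at h10; rw [hr00, hr11] at h11
    refine ⟨(mul_eq_zero.mp h01).resolve_left hb, (mul_eq_zero.mp h10).resolve_left hb, ?_⟩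
    have : b * (G 1 1 - G 0 0) = 0 := by linear_combination h11
    exact sub_eq_zero.mp ((mul_eq_zero.mp this).resolve_left hb)
  have htr : r 0 0 + r 1 1 = 0 := trace_zero_of_sq hr hns_r
  have htr' : 2 * a + b * (G 0 0 + G 1 1) = 0 := by
    rw [hr00, hr11] at htr; linear_combination htr
  obtain ⟨P, hP⟩ := exists_conj_stdSinger hr hns_r
  have hconj : ∀ x ∈ H, IsSingerNormal c (P⁻¹ * x * P) := by
    intro x hx
    rcases hfs x hx with ⟨h1, h2⟩ | ⟨h1, h2⟩
    · have hcomm := E.comm_of_fix h1 h2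
      rw [← hGdef] at hcomm
      have hxr : (x : Mat p 2) * r = (1 : ZMod p) • (r * (x : Mat p 2)) := by
        simp only [hrdef, Matrix.mul_add, Matrix.add_mul, Matrix.mul_smul, Matrix.smul_mul,
          Matrix.mul_one, Matrix.one_mul, one_smul, hcomm]
      have := conj_comm_transport hP x 1 hxr
      rw [one_smul] at this
      exact isSingerNormal_of_comm_std this
    · have hanti := E.anticomm_of_swap h1 h2 a b htr'
      have hxr : (x : Mat p 2) * r = (-1 : ZMod p) • (r * (x : Mat p 2)) := by
        rw [neg_one_smul]; exact hanti
      have := conj_comm_transport hP x (-1) hxr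
      rw [neg_one_smul] at this
      exact isSingerNormal_of_anticomm_std this
  rcases hc with rfl | rfl
  · -- `c = 1`: one more conjugation lands in the monomial group
    left
    refine ⟨(hadamardGL hp2)⁻¹ * P⁻¹, fun x hx => ?_⟩
    have : (hadamardGL hp2)⁻¹ * P⁻¹ * x * ((hadamardGL hp2)⁻¹ * P⁻¹)⁻¹ =
        (hadamardGL hp2)⁻¹ * (P⁻¹ * x * P) * hadamardGL hp2 := by group
    rw [this]
    exact isMonomial_hadamard_conj hp2 (hconj x hx)
  · right
    refine ⟨P⁻¹, fun x hx => ?_⟩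
    rw [inv_inv]
    exact hconj x hx

/-! ### Dickson's list -/

/-- The kernel of the action of `H` on `ℙ¹(K̄)` is no larger than the scalar part of `H`. -/
theorem card_actKer_le (H : Subgroup (GLm p 2)) :
    Nat.card (actKer H (PL p)) ≤ Nat.card (H.comap (scalarHom p 2)) := by
  have hmem : ∀ u : H.comap (scalarHom p 2), scalarHom p 2 (u : (ZMod p)ˣ) ∈ H := fun u =>
    Subgroup.mem_comap.mp u.2
  have hker : ∀ u : H.comap (scalarHom p 2),
      (⟨scalarHom p 2 (u : (ZMod p)ˣ), hmem u⟩ : H) ∈ actKer H (PL p) := by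
    intro u
    rw [mem_actKer]
    intro x
    rw [Subgroup.mk_smul]
    exact smul_eq_self_of_mem_range (MonoidHom.mem_range.mpr ⟨(u : (ZMod p)ˣ), rfl⟩) x
  let f : H.comap (scalarHom p 2) → actKer H (PL p) := fun u => ⟨_, hker u⟩
  refine Nat.card_le_card_of_surjective f fun γ => ?_
  have hγ : ∀ x : PL p, ((γ : H) : GLm p 2) • x = x := fun x => by
    rw [← Subgroup.smul_def]; exact mem_actKer.mp γ.2 x
  obtain ⟨u, hu⟩ := mem_range_scalarHom_of_forall_smul hγ
  have huH : u ∈ H.comap (scalarHom p 2) := by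
    rw [Subgroup.mem_comap, hu]; exact (γ : H).2
  refine ⟨⟨u, huH⟩, ?_⟩
  apply Subtype.ext; apply Subtype.ext
  exact hu

/-- **Dickson's list** for `p`-free subgroups of `GL₂(𝔽_p)`, `p` odd. -/
theorem dicksonList_holds (hp2 : p ≠ 2) {n : ZMod p} (hn : ∀ x : ZMod p, x * x ≠ n) :
    DicksonList p n := by
  intro H hH
  have hfb : ∀ γ : H, MulAction.fixedBy (PL p) γ = MulAction.fixedBy (PL p) (γ : GLm p 2) := by
    intro γ; ext x; simp only [MulAction.mem_fixedBy, Subgroup.smul_def]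
  have hns_of : ∀ γ : H, γ ∉ actKer H (PL p) → (γ : GLm p 2) ∉ (scalarHom p 2).range := by
    intro γ hγ hmem
    apply hγ
    rw [mem_actKer]
    intro x
    rw [Subgroup.smul_def]
    exact smul_eq_self_of_mem_range hmem x
  have h2 : ∀ γ : H, γ ∉ actKer H (PL p) →
      ∃ x y : PL p, x ≠ y ∧ MulAction.fixedBy (PL p) γ = {x, y} := by
    intro γ hγ
    obtain ⟨E⟩ := exists_eigenData hp2 (disc_ne_zero_of_pfree hp2 hH γ.2 (hns_of γ hγ))
    rw [hfb]
    exact ⟨_, _, E.mk_ne, E.fixedBy_eq_pair⟩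
  rcases two_point_action h2 with hK | ⟨x, y, hxy, ⟨γ₀, hγ₀, hF⟩, hall⟩ | hcard
  · -- `H` is scalar
    left
    refine ⟨1, fun x hx => ?_⟩
    have hx' : (⟨x, hx⟩ : H) ∈ actKer H (PL p) := by rw [hK]; exact Subgroup.mem_top _
    rw [mem_actKer] at hx'
    have hsc := mem_range_scalarHom_of_forall_smul (g := x) fun z => by
      rw [← Subgroup.mk_smul x hx z]; exact hx' z
    rw [mem_range_scalarHom_iff] at hsc
    rw [one_mul, inv_one, mul_one]
    exact Or.inl ⟨hsc.1, hsc.2.1⟩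
  · -- an invariant pair of eigenlines
    have hns := hns_of γ₀ hγ₀
    obtain ⟨E⟩ := exists_eigenData hp2 (disc_ne_zero_of_pfree hp2 hH γ₀.2 hns)
    have hpair : ({x, y} : Set (PL p)) =
        {Projectivization.mk (Kb p) E.u E.hu, Projectivization.mk (Kb p) E.w E.hw} := by
      rw [← hF, hfb]; exact E.fixedBy_eq_pair
    have hfs : ∀ h ∈ H,
        (h • Projectivization.mk (Kb p) E.u E.hu = Projectivization.mk (Kb p) E.u E.hu ∧
          h • Projectivization.mk (Kb p) E.w E.hw = Projectivization.mk (Kb p) E.w E.hw) ∨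
        (h • Projectivization.mk (Kb p) E.u E.hu = Projectivization.mk (Kb p) E.w E.hw ∧
          h • Projectivization.mk (Kb p) E.w E.hw = Projectivization.mk (Kb p) E.u E.hu) := by
      intro h hh
      have hh' := hall ⟨h, hh⟩
      simp only [Subgroup.mk_smul] at hh'
      rcases Set.pair_eq_pair_iff.mp hpair with ⟨hx, hy⟩ | ⟨hx, hy⟩
      · subst hx hy; exact hh'
      · subst hx hy
        rcases hh' with ⟨e1, e2⟩ | ⟨e1, e2⟩
        · exact Or.inl ⟨e2, e1⟩
        · exact Or.inr ⟨e2, e1⟩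
    rcases dickson_of_invariant_pair hp2 hn hH γ₀.2 hns E hfs with h | h
    · exact Or.inl h
    · exact Or.inr (Or.inl h)
  · -- small projective image
    right; right
    have hsc := card_eq_scalar_mul_card_image H
    have hle := card_actKer_le (p := p) H
    have hpos : 0 < Nat.card (H.comap (scalarHom p 2)) := Nat.card_pos
    apply Nat.le_of_mul_le_mul_left _ hpos
    rw [← hsc]
    calc Nat.card H ≤ 60 * Nat.card (actKer H (PL p)) := hcard
      _ ≤ 60 * Nat.card (H.comap (scalarHom p 2)) := Nat.mul_le_mul_left _ hle
      _ = Nat.card (H.comap (scalarHom p 2)) * 60 := mul_comm _ _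

/-- Dickson's list in the form consumed by `no_levelOne_witness_of_dicksonList_all'`. -/
theorem dicksonList_all (hp2 : p ≠ 2) :
    ∀ n : ZMod p, (∀ x : ZMod p, x * x ≠ n) → DicksonList p n :=
  fun _ hn => dicksonList_holds hp2 hn

/-! ### The `(2,1)` cell is empty for every prime `p ≥ 47` -/

/-- **The `(2,1)` cell is empty, unconditionally, for all primes `p ≥ 47` and all `0 < ε ≤ 1`.**
No TPP triple of subgroups of `GL₂(𝔽_p)` with a level-`1` design beats the level-`1` budget.
VALUE = theorem on one cell of the crux, NOT summit progress. -/
theorem cellTwoOne_empty (hp47 : 47 ≤ p) {ε : ℝ} (hε : 0 < ε) (hε1 : ε ≤ 1)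
    {H₁ H₂ H₃ : Subgroup (GLm p 2)} (htpp : SubgroupTPP H₁ H₂ H₃)
    (hdesign : ∃ c : Mat p 2 → ℂ, (∀ M, 1 < M.rank → c M = 0) ∧
      (∑ M, c M * ZMod.stdAddChar (Matrix.trace (M * ((1 : GLm p 2) : Mat p 2)))) = 1 ∧
      ∀ a ∈ H₁, ∀ b ∈ H₂, ∀ g ∈ H₃, a * b * g ≠ 1 →
        (∑ M, c M *
          ZMod.stdAddChar (Matrix.trace (M * ((a * b * g : GLm p 2) : Mat p 2)))) = 0) :
    ¬ budget p 2 1 (2 + ε) <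
      ((Nat.card H₁ * Nat.card H₂ * Nat.card H₃ : ℕ) : ℝ) ^ ((2 + ε) / 3) :=
  no_levelOne_witness_of_dicksonList_all' hp47 (dicksonList_all (by omega)) hε hε1 htpp hdesign

end DicksonTheorem

end Summit.MatrixMultiplication.MatrixMultiplication.Theorems.SubgroupIdentityDesigns.Negative

end
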